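import Summits.AnomalousDissipation.AnomalousDissipation.Theorems.SolenoidalFractalHomogenisationLagrangianStepDefs
import Summits.AnomalousDissipation.AnomalousDissipation.Theorems.SolenoidalFractalHomogenisationLagrangianRenormalisationStepExistsL
import HarnessLib

/-!
# K1L `LagrangianRenormalisationStep` (stmt-AnomalousDissipation-24912), registered line `birth` (skeleton r17 v9):
# the registered stub `stub_existsL` BY NAME (helper; `--supports stmt-AnomalousDissipation-24912`)

Summits-side helper file (everything proved; no definitions, no named facts). `stub_existsL` has, literally, the signature of the
registered stub of the K1L birth skeleton (`HOME/ad-ideate-p1/r17/LagrangianRenormalisationStep_birth_v9_lit_tree.lean` l.286,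
skeleton sha 44fd45a3…; shared vocabulary `VF` / `IsDatum` / `TSol` from `…LagrangianStepDefs`, p610007): for every L-permissible,
regular Lagrangian lattice carrier `E`, every level `m` and every admissible datum `w₀` (`H¹`, mean zero, weakly divergence free) the
top-level TRUNCATED problem — passive solenoidal vector along the partial sum `E.partialSum m = b 1 + ⋯ + b m` at the scalar viscosity
`E.kbar m`, written in the tensor class at `𝔸 = isoVisc (E.kbar m)` — has a weak solution on `[0,1)`.

Proof = the per-level regularity package of the AMENDED `LagrangianLatticeCarrier.Regular` (planner ruling R22-1 on finding F-g5-1,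
cell ad-ideate 2026-08-28: `Regular` now carries `LevelRegular`, in particular (L1) joint continuity and (L2) weak divergence-freeness of
every level field `b (i+1)`) fed into the landed inner lemma `LagrangianRenormalisationStep.existsL_of_levels` (p610252, lead
ad-solenoidal-k2r-lowerlaw-p1 g5: continuity of the partial sum ⇒ `stLift ∈ L^∞((0,1) × ℝ³)`, finite sums of continuous weakly
divergence-free fields, `H¹ ⇒ L²`, J.-L. Lions' existence theorem `Torus.exists_isWeakPassiveVectorOn`, and the bridge
`IsWeakPassiveVectorOn.toTensor`). `E.LPermissible` is not used.
This is NOT a proof of Onsager's conjecture nor of anomalous dissipation, and by itself not of the crux (one of six registered stubs).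
-/

set_option linter.dupNamespace false

noncomputable section

namespace Summit.AnomalousDissipation.AnomalousDissipation.Theorems.SolenoidalFractalHomogenisation.LagrangianStep

open Literature.Analysis Literature.Analysis.FluidPDE Literature.Analysis.FunctionSpaces
open MeasureTheory Set Filter
open scoped ENNReal NNReal InnerProductSpace

/-- **Registered stub `stub_existsL` of K1L's line `birth`** (signature verbatim): weak solutions of the top-level truncated problem exist
for admissible data — Lions' theorem along the jointly continuous, weakly divergence-free partial sum `b 1 + ⋯ + b m` (levels regular by
`Regular.levelRegular`, clauses (L1)/(L2)). [cite: LionsMagenes1972, Chap. 3 Thm. 1.1] -/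
theorem stub_existsL : ∀ k (E : LatticeShear.LagrangianLatticeCarrier k), E.LPermissible → E.Regular →
    ∀ (m : ℕ) (w₀ : VF), IsDatum w₀ → ∃ u, TSol E m (Torus.isoVisc (E.kbar m)) w₀ u := by
  intro k E _ hR m w₀ hw₀
  exact LagrangianRenormalisationStep.existsL_of_levels E m (fun i _ => hR.levelRegular.continuous_uncurry_b i)
    (fun i _ t => hR.levelRegular.isWeaklyDivFree_b i t) w₀ hw₀

end Summit.AnomalousDissipation.AnomalousDissipation.Theorems.SolenoidalFractalHomogenisation.LagrangianStep

end
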